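import Mathlib
import HarnessLib
import Summits.HubbardSuperconductivity.HubbardSuperconductivity.Theorems.KLProgrammeKLRegimeIsoSectorMultiplierFat
import Summits.HubbardSuperconductivity.HubbardSuperconductivity.Theorems.KLProgrammeKLRegimeEngineNormsJumpResectorisation
import Summits.HubbardSuperconductivity.HubbardSuperconductivity.Theorems.KLProgrammeH10TwoPointLimitSectorMultiplierJumpRegime
import Summits.HubbardSuperconductivity.HubbardSuperconductivity.Theorems.KLProgrammeH10TwoPointLimitIsoTorusSum
import Summits.HubbardSuperconductivity.HubbardSuperconductivity.Theorems.KLProgrammeKLRegimeEngineV8IsoTupleExport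
import Summits.HubbardSuperconductivity.HubbardSuperconductivity.Theorems.KLProgrammeKLRegimeEngineV8DefsU9

/-!
# Route `KLProgramme` — ENGINE item stmt-HubbardSuperconductivity-20437 `KLRegimeEngineV17F2`, class #6 (`IsoTupleLineAt`, the (X).2 conjunct
# `∃ e, IsIsoPkgW P CF e ∧ IsoTupleLineStepW P R Q e…`) PRODUCER SIDE: the ISO(m) ← THIN(n₂) SINGLE-TUPLE RE-SECTORISATION of the scale-`n`
# quartic kernel, and the class-#6 door «any per-thin-tuple line ⟹ `IsoTupleLineAt`»

Cell gate-hubbard-kl, seat hubbard-kl-k3c2-p2 (g10; class-#6 text owner).  `IsoTupleLineAt L M a b P β U μ n` is the fixed-tuple `L¹` size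
`fixedTupleL1 β 3 (klIsoKernelAt … K_n n m) Ω x₁ ≤ a·U + b·(Klam U)²` of the scale-`n` quartic kernel sectorised with the ISOTROPIC family of
every resolution `m ≥ n`.  Whatever produces it (stub (b)'s weighted tower, a sign-resolved value-lane analysis — CLASS6-WORD §B, E1 questions (7)/(8))
measures kernels in the THIN families `klAnisoFamily … n₂`.  This file is the currency-free bridge:

* §1 **`hubbardSectorPinnedSum_klIso_of_klAniso_le`** — the KL instance of the per-tuple plateau-pair re-sectorisation
  `Literature…RefinementPlateau.hubbardSectorPinnedSum_refine_le_of_plateau_pair` for the pair (thin `n₂`, fat `n₂` ; iso `m`), `n₂ + 1 ≤ m`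
  (plateau: `TorusFourierL2.sum_klAnisoFamily_eq_one_of_klIsoFamily_ne_zero`), for EVERY Grassmann polynomial `G` and degree `d + 1`:
  one iso label tuple's pinned size `≤ c₁^d · c₁r · P · ε^d · (ε·B)` from the per-pair overlap sums `c₁, c₁r` of `E(klIsoFamily m)·S(F̃_{n₂})`, the
  parents count `P` and the per-thin-tuple pinned sizes `B`; `card_parents_klIso_le` (`P ≤ 27^{d+1}`, `n₂ ≤ 2m`);
* §2 `fixedTupleL1_eq_pinnedSum` (the class-#6 size IS the pinned sum through leg `0`) and **`fixedTupleL1_klIsoKernelAt_le_of_klAniso`**: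
  `fixedTupleL1 β 3 (klIsoKernelAt … K n m) Ω x₁ ≤ c₁³·c₁r·27⁴·ε³·(ε·B)` from the per-tuple pinned sizes `B` of `klAnisoKernelAt … K n n₂` (`n₂ + 1 ≤ m`);
* §3 **`overlap_pairSums_klIso_klEng`** — IN THE KL REGIME, under exactly the binders of the registered stubs of 20437 (`P.WF`, `R.WF2`,
  `0 < c ≤ klEngC₃6 P R`, `μ ∈ klWindowC`, `0 < U ≤ klEngU₀9 P R c`, `klBetaMin ≤ β ≤ e^{c/U²}`, `FrameOK R U (nScales β) μ K`, `klEngL₃ β U ≤ L`,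
  `klEngM₃ β U L ≤ M`): `∃ C_I > 0`, for every `1 ≤ n₂ ≤ nScales β + 1` and `m ≥ n₂ + 1`, the per-pair column and row sums of `E(iso m)·S(F̃_{n₂})` are
  `≤ C_I·M/β` — from the engine's isotropic torus constant (`isoTorusBoundAt_klIsoT`, via `charSum_klIso_single_le_of_padded`), the thin single
  bound (`charSum_klAniso_single_le` on `charSum_klAnisoPair_nb_of_thresholds`) and product-torus Young (`overlap_pairSums_klIso_bgmFat_le_of_singles`);
* §4 **THE CLASS-#6 DOOR `isoTupleLineAt_of_anisoTupleLine_klEng`** — `∃ C_re > 0` such that, under the same binders at the flowing frame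
  `K_n = klFlowFrameU … n` and for `1 ≤ n₂`, `n₂ + 1 ≤ n ≤ nScales β + 2`: if every thin label tuple `σ′` of index `n₂`, every leg `p` and every pinned
  point `y` has `ε³·Σ_{x′_p = y} ‖klAnisoKernelAt … K_n n n₂ σ′ x′‖ ≤ a·U + b·(Klam U)²`, then `IsoTupleLineAt L M (C_re·a) (C_re·b) P β U μ n`.  So the
  (X).2 producer may deliver its single-tuple line in THIN currency at its own index (`n₂ = n − 1`, the finest allowed); the constant is absolute.

Scope: `n₂ ≥ 1` (the thin single bound is the neighbouring-pair one); the case `n = 1` (`n₂ = 0`, the two-sector scale-`0` family) needs the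
scale-`0` family's character sum and is not in this file.  Everything is proved; no definitions; nothing about the model is asserted beyond these
implications. [cite: BenfattoGiulianiMastropietro2006, §2.5 (2.57), §2.7 (2.71a), §2.8 (2.82)–(2.83)]
-/

noncomputable section

namespace Summit.HubbardSuperconductivity.HubbardSuperconductivity.Theorems.EngineV8

set_option linter.dupNamespace false -- summit = problem name (single-conjunct summit), D-0017

open Classical
open Real Finset Literature.MathematicalPhysics.QuantumLattice Literature.Probability.LatticeModels GrassmannAlgebra
open Summit.HubbardSuperconductivity.HubbardSuperconductivity.Theorems.KLProgrammeLegKernels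
open Summit.HubbardSuperconductivity.HubbardSuperconductivity.Theorems.KLRegimeSplit
open Summit.HubbardSuperconductivity.HubbardSuperconductivity.Theorems.TorusFourierL2

variable {L M : ℕ} [NeZero L] [NeZero M]

/-! ## §1 The per-tuple re-sectorisation iso(m) ← thin(n₂) -/

/-- **Per-tuple re-sectorisation, iso from thin** (BGM 2006 (2.82)–(2.83), per-tuple companion): for `n₂ + 1 ≤ m`, every Grassmann polynomial `G`,
degree `d + 1`, one ISO label tuple `σ″` of resolution `m`, leg `p` and point `x`:
`ε^d Σ_{x″_p = x} ‖W_{iso m,σ″}(x″)‖ ≤ c₁^d · c₁r · P · ε^d · (ε · B)`, given per-pair column sums `≤ c₁` and row sums `≤ c₁r` of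
`‖E(klIsoFamily … m)·S(F̃_{n₂})‖` (labels matched), at most `P` thin label tuples of index `n₂` overlapping `σ″` leg by leg (support overlap with the fat
multiplier, same spin and charge), and single-tuple pinned sizes `≤ B` of `G` in `klAnisoFamily … n₂`. [cite: BenfattoGiulianiMastropietro2006, §2.8 (2.82)-(2.83)] -/
theorem hubbardSectorPinnedSum_klIso_of_klAniso_le {β : ℝ} (hβ : 0 < β) (μ : ℝ) (K : TrigPolyC4v) {e₀ : ℝ} (he : 0 < e₀) {n₂ m : ℕ}
    (hm : n₂ + 1 ≤ m) (G : HubbardGrassmann L M) {c₁ c₁r Pc B : ℝ} (hc₁0 : 0 ≤ c₁) (hc₁r0 : 0 ≤ c₁r) (hB0 : 0 ≤ B)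
    (hcol₁ : ∀ (σ : Fin (sectorCount (2 * m))) (ω' : Fin (sectorCount n₂)) (s c : Fin 2) (x' : SpaceTimeIdx L M),
      ∑ x'' : SpaceTimeIdx L M, ‖(sectorAnalysisMatrix L M β (klIsoFamily L M β μ K e₀ m) *
        sectorSubMatrix L M β (bgmFatMultiplier L M e₀ β (nambuXiCT L μ K) n₂)) (x'', ((σ, s), c)) (x', ((ω', s), c))‖ ≤ c₁)
    (hrow₁ : ∀ (σ : Fin (sectorCount (2 * m))) (ω' : Fin (sectorCount n₂)) (s c : Fin 2) (x'' : SpaceTimeIdx L M),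
      ∑ x' : SpaceTimeIdx L M, ‖(sectorAnalysisMatrix L M β (klIsoFamily L M β μ K e₀ m) *
        sectorSubMatrix L M β (bgmFatMultiplier L M e₀ β (nambuXiCT L μ K) n₂)) (x'', ((σ, s), c)) (x', ((ω', s), c))‖ ≤ c₁r)
    (d : ℕ)
    (hPc : ∀ σ'' : Fin (d + 1) → SectorLeg (sectorCount (2 * m)),
      (((univ.filter fun σ' : Fin (d + 1) → SectorLeg (sectorCount n₂) => ∀ i,
          (∃ q : FreqMomentum L M, klIsoFamily L M β μ K e₀ m (σ'' i).1.1 q ≠ 0 ∧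
            bgmFatMultiplier L M e₀ β (nambuXiCT L μ K) n₂ (σ' i).1.1 q ≠ 0) ∧
          (σ' i).1.2 = (σ'' i).1.2 ∧ (σ' i).2 = (σ'' i).2).card : ℝ)) ≤ Pc)
    (hBF : ∀ (σ' : Fin (d + 1) → SectorLeg (sectorCount n₂)) (p : Fin (d + 1)) (y : SpaceTimeIdx L M),
      imagTimeWeight β M ^ d * ∑ x' ∈ univ.filter (fun x' : Fin (d + 1) → SpaceTimeIdx L M => x' p = y),
        ‖sectorisedKernel L M β (klAnisoFamily L M β μ K e₀ n₂) G (d + 1) σ' x'‖ ≤ B)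
    (σ'' : Fin (d + 1) → SectorLeg (sectorCount (2 * m))) (p : Fin (d + 1)) (x : SpaceTimeIdx L M) :
    imagTimeWeight β M ^ d * ∑ x'' ∈ univ.filter (fun x'' : Fin (d + 1) → SpaceTimeIdx L M => x'' p = x),
        ‖sectorisedKernel L M β (klIsoFamily L M β μ K e₀ m) G (d + 1) σ'' x''‖ ≤
      c₁ ^ d * c₁r * Pc * imagTimeWeight β M ^ d * (imagTimeWeight β M * B) := by
  set F' := klIsoFamily L M β μ K e₀ m with hF'
  set F := klAnisoFamily L M β μ K e₀ n₂ with hF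
  set Ft := bgmFatMultiplier L M e₀ β (nambuXiCT L μ K) n₂ with hFt
  -- the per-pair position sums for arbitrary label pairs: mismatched spin/charge entries vanish
  have hcol₁' : ∀ (ℓ'' : SectorLeg (sectorCount (2 * m))) (X' : SpaceTimeIdx L M × SectorLeg (sectorCount n₂)),
      ∑ x'' : SpaceTimeIdx L M, ‖(sectorAnalysisMatrix L M β F' * sectorSubMatrix L M β Ft) (x'', ℓ'') X'‖ ≤ c₁ := by
    rintro ⟨⟨ω'', σ''⟩, c''⟩ ⟨x', ⟨ω', σ'⟩, c'⟩
    by_cases hlab : σ' = σ'' ∧ c' = c''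
    · obtain ⟨rfl, rfl⟩ := hlab
      exact hcol₁ ω'' ω' σ' c' x'
    · refine le_of_eq_of_le (sum_eq_zero fun x'' _ => ?_) hc₁0
      rw [sectorAnalysis_mul_sectorSub_apply, if_neg (by exact hlab), norm_zero]
  have hrow₁' : ∀ (X'' : SpaceTimeIdx L M × SectorLeg (sectorCount (2 * m))) (ℓ' : SectorLeg (sectorCount n₂)),
      ∑ x' : SpaceTimeIdx L M, ‖(sectorAnalysisMatrix L M β F' * sectorSubMatrix L M β Ft) X'' (x', ℓ')‖ ≤ c₁r := by
    rintro ⟨x'', ⟨ω'', σ''⟩, c''⟩ ⟨⟨ω', σ'⟩, c'⟩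
    by_cases hlab : σ' = σ'' ∧ c' = c''
    · obtain ⟨rfl, rfl⟩ := hlab
      exact hrow₁ ω'' ω' σ' c' x''
    · refine le_of_eq_of_le (sum_eq_zero fun x' _ => ?_) hc₁r0
      rw [sectorAnalysis_mul_sectorSub_apply, if_neg (by exact hlab), norm_zero]
  have h := hubbardSectorPinnedSum_refine_le_of_plateau_pair hβ F Ft
    (fun ω q => bgmFatMultiplier_mul_bgmMultiplier he β (nambuXiCT L μ K) n₂ ω q)
    (fun q hq ω => klAnisoFamily_eq_zero_of_sum_eq_zero β μ K e₀ n₂ q hq ω) F'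
    (fun ω' q hne => sum_klAnisoFamily_eq_one_of_klIsoFamily_ne_zero he β μ K hm ω' q hne) G
    (fun ω'' ω' => ∃ q : FreqMomentum L M, F' ω'' q ≠ 0 ∧ Ft ω' q ≠ 0)
    (fun ω'' ω' hno q => by
      by_contra hq
      exact hno ⟨q, (mul_ne_zero_iff.1 hq).1, (mul_ne_zero_iff.1 hq).2⟩)
    hc₁0 hc₁r0 hB0 hcol₁' hrow₁' d (fun σ''₀ => by convert hPc σ''₀ using 4) hBF σ'' p x
  exact h

omit [NeZero M] in
/-- **The parents count, discharged**: an ISO label tuple `σ″` of resolution `m` overlaps leg by leg (support overlap with the FAT multiplier of index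
`n₂ ≤ 2m`, same spin and charge) at most `27^{d+1}` thin label tuples of index `n₂` (`card_overlap_klIso_bgmFat_coarse_le`, leg by leg). -/
theorem card_parents_klIso_le (β μ : ℝ) (K : TrigPolyC4v) {e₀ : ℝ} (he : 0 < e₀) {n₂ m : ℕ} (hn : n₂ ≤ 2 * m) (d : ℕ)
    (σ'' : Fin (d + 1) → SectorLeg (sectorCount (2 * m))) :
    (((univ.filter fun σ' : Fin (d + 1) → SectorLeg (sectorCount n₂) => ∀ i,
        (∃ q : FreqMomentum L M, klIsoFamily L M β μ K e₀ m (σ'' i).1.1 q ≠ 0 ∧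
          bgmFatMultiplier L M e₀ β (nambuXiCT L μ K) n₂ (σ' i).1.1 q ≠ 0) ∧
        (σ' i).1.2 = (σ'' i).1.2 ∧ (σ' i).2 = (σ'' i).2).card : ℝ)) ≤ 27 ^ (d + 1) := by
  -- leg by leg: the admissible coarse labels of leg `i`
  set t : Fin (d + 1) → Finset (SectorLeg (sectorCount n₂)) := fun i => univ.filter fun ℓ' : SectorLeg (sectorCount n₂) =>
      (∃ q : FreqMomentum L M, klIsoFamily L M β μ K e₀ m (σ'' i).1.1 q ≠ 0 ∧
        bgmFatMultiplier L M e₀ β (nambuXiCT L μ K) n₂ ℓ'.1.1 q ≠ 0) ∧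
      ℓ'.1.2 = (σ'' i).1.2 ∧ ℓ'.2 = (σ'' i).2 with ht
  have hsub : (univ.filter fun σ' : Fin (d + 1) → SectorLeg (sectorCount n₂) => ∀ i,
        (∃ q : FreqMomentum L M, klIsoFamily L M β μ K e₀ m (σ'' i).1.1 q ≠ 0 ∧
          bgmFatMultiplier L M e₀ β (nambuXiCT L μ K) n₂ (σ' i).1.1 q ≠ 0) ∧
        (σ' i).1.2 = (σ'' i).1.2 ∧ (σ' i).2 = (σ'' i).2) ⊆ Fintype.piFinset t := by
    intro σ' hσ'
    rw [Fintype.mem_piFinset]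
    intro i
    simp only [ht, mem_filter, mem_univ, true_and]
    exact (mem_filter.1 hσ').2 i
  have hti : ∀ i, (t i).card ≤ 27 := by
    intro i
    calc (t i).card ≤ ((univ : Finset (Fin (sectorCount n₂))).filter (fun ω₂ : Fin (sectorCount n₂) =>
          ∃ q : FreqMomentum L M, klIsoFamily L M β μ K e₀ m (σ'' i).1.1 q ≠ 0 ∧
            bgmFatMultiplier L M e₀ β (nambuXiCT L μ K) n₂ ω₂ q ≠ 0)).card := by
          refine Finset.card_le_card_of_injOn (fun ℓ' : SectorLeg (sectorCount n₂) => ℓ'.1.1) (fun ℓ' hℓ' => ?_)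
            (fun ℓ₁ h₁ ℓ₂ h₂ heq => ?_)
          · simp only [ht, mem_coe, mem_filter, mem_univ, true_and] at hℓ' ⊢
            exact hℓ'.1
          · simp only [ht, mem_coe, mem_filter, mem_univ, true_and] at h₁ h₂
            exact Prod.ext (Prod.ext heq (h₁.2.1.trans h₂.2.1.symm)) (h₁.2.2.trans h₂.2.2.symm)
      _ ≤ 27 := card_overlap_klIso_bgmFat_coarse_le he β μ K hn _
  calc (((univ.filter fun σ' : Fin (d + 1) → SectorLeg (sectorCount n₂) => ∀ i,
        (∃ q : FreqMomentum L M, klIsoFamily L M β μ K e₀ m (σ'' i).1.1 q ≠ 0 ∧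
          bgmFatMultiplier L M e₀ β (nambuXiCT L μ K) n₂ (σ' i).1.1 q ≠ 0) ∧
        (σ' i).1.2 = (σ'' i).1.2 ∧ (σ' i).2 = (σ'' i).2).card : ℝ))
      ≤ (Fintype.piFinset t).card := by exact_mod_cast card_le_card hsub
    _ = ∏ i, ((t i).card : ℝ) := by rw [Fintype.card_piFinset]; push_cast; rfl
    _ ≤ ∏ _i : Fin (d + 1), (27 : ℝ) := prod_le_prod (fun i _ => by positivity) (fun i _ => by exact_mod_cast hti i)
    _ = 27 ^ (d + 1) := by rw [prod_const, card_univ, Fintype.card_fin]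

/-! ## §2 The class-#6 size: `fixedTupleL1` of the iso-sectorised quartic kernel from the per-thin-tuple sizes -/

omit [NeZero M] in
/-- **The fixed-tuple size IS the pinned sum through leg `0`**: `fixedTupleL1 β d W Ω x₁ = ε^d · Σ_{x′ : x′_0 = x₁} ‖W_Ω(x′)‖`. -/
theorem fixedTupleL1_eq_pinnedSum {Ns d : ℕ} (β : ℝ) (W : (Fin (d + 1) → SectorLeg Ns) → (Fin (d + 1) → SpaceTimeIdx L M) → ℂ)
    (Ω : Fin (d + 1) → SectorLeg Ns) (x₁ : SpaceTimeIdx L M) :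
    fixedTupleL1 L M β d W Ω x₁ =
      imagTimeWeight β M ^ d * ∑ x' ∈ univ.filter (fun x' : Fin (d + 1) → SpaceTimeIdx L M => x' 0 = x₁), ‖W Ω x'‖ := by
  unfold fixedTupleL1
  rw [sum_filter_apply_eq]
  congr 1
  refine sum_congr rfl fun x _ => ?_
  rw [Fin.insertNth_zero']
  rfl

/-- **The iso fixed-tuple size from the per-thin-tuple pinned sizes** (`n₂ + 1 ≤ m`, four legs): for every frame `K`, scale `n`, iso label tuple
`Ω` of resolution `m` and pinned point `x₁`,
`fixedTupleL1 β 3 (klIsoKernelAt … K n m) Ω x₁ ≤ c₁³ · c₁r · 27⁴ · ε³ · (ε · B)`, given per-pair column/row sums `≤ c₁ / c₁r` of `E(klIsoFamily m)·S(F̃_{n₂})`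
and the pinned sizes `ε³·Σ_{x′_p = y} ‖klAnisoKernelAt … K n n₂ σ′ x′‖ ≤ B` of EVERY thin label tuple `σ′` of index `n₂`, every leg `p`, every `y`.
[cite: BenfattoGiulianiMastropietro2006, §2.8 (2.82)-(2.83)] -/
theorem fixedTupleL1_klIsoKernelAt_le_of_klAniso {β : ℝ} (hβ : 0 < β) (U μ : ℝ) (K : TrigPolyC4v) (n : ℕ) {n₂ m : ℕ} (hm : n₂ + 1 ≤ m)
    {c₁ c₁r B : ℝ} (hc₁0 : 0 ≤ c₁) (hc₁r0 : 0 ≤ c₁r) (hB0 : 0 ≤ B)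
    (hcol₁ : ∀ (σ : Fin (sectorCount (2 * m))) (ω' : Fin (sectorCount n₂)) (s c : Fin 2) (x' : SpaceTimeIdx L M),
      ∑ x'' : SpaceTimeIdx L M, ‖(sectorAnalysisMatrix L M β (klIsoFamily L M β μ K klE0 m) *
        sectorSubMatrix L M β (bgmFatMultiplier L M klE0 β (nambuXiCT L μ K) n₂)) (x'', ((σ, s), c)) (x', ((ω', s), c))‖ ≤ c₁)
    (hrow₁ : ∀ (σ : Fin (sectorCount (2 * m))) (ω' : Fin (sectorCount n₂)) (s c : Fin 2) (x'' : SpaceTimeIdx L M),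
      ∑ x' : SpaceTimeIdx L M, ‖(sectorAnalysisMatrix L M β (klIsoFamily L M β μ K klE0 m) *
        sectorSubMatrix L M β (bgmFatMultiplier L M klE0 β (nambuXiCT L μ K) n₂)) (x'', ((σ, s), c)) (x', ((ω', s), c))‖ ≤ c₁r)
    (hBF : ∀ (σ' : Fin 4 → SectorLeg (sectorCount n₂)) (p : Fin 4) (y : SpaceTimeIdx L M),
      imagTimeWeight β M ^ 3 * ∑ x' ∈ univ.filter (fun x' : Fin 4 → SpaceTimeIdx L M => x' p = y),
        ‖klAnisoKernelAt L M β U μ K n n₂ σ' x'‖ ≤ B)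
    (Ω : Fin 4 → SectorLeg (sectorCount (2 * m))) (x₁ : SpaceTimeIdx L M) :
    fixedTupleL1 L M β 3 (klIsoKernelAt L M β U μ K n m) Ω x₁ ≤
      c₁ ^ 3 * c₁r * 27 ^ 4 * imagTimeWeight β M ^ 3 * (imagTimeWeight β M * B) := by
  have he : (0 : ℝ) < klE0 := by norm_num [klE0]
  rw [fixedTupleL1_eq_pinnedSum]
  have h := hubbardSectorPinnedSum_klIso_of_klAniso_le hβ μ K he hm (klEffectiveAction L M β U μ K klE0 n) hc₁0 hc₁r0 hB0 hcol₁ hrow₁ 3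
    (fun σ'' => card_parents_klIso_le β μ K he (by omega) 3 σ'') (fun σ' p y => hBF σ' p y) Ω 0 x₁
  calc imagTimeWeight β M ^ 3 * ∑ x' ∈ univ.filter (fun x' : Fin (3 + 1) → SpaceTimeIdx L M => x' 0 = x₁),
        ‖klIsoKernelAt L M β U μ K n m Ω x'‖
      ≤ c₁ ^ 3 * c₁r * 27 ^ (3 + 1) * imagTimeWeight β M ^ 3 * (imagTimeWeight β M * B) := h
    _ = c₁ ^ 3 * c₁r * 27 ^ 4 * imagTimeWeight β M ^ 3 * (imagTimeWeight β M * B) := by norm_num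

/-! ## §3 The per-pair overlap sums of `E(iso m)·S(F̃_{n₂})` in the KL regime — ONE absolute constant -/

/-- **The per-pair overlap sums of the iso × fat pair in the KL regime**: `∃ C_I > 0` such that, under exactly the binders of the registered stubs of
item 20437 (`P.WF`, `R.WF2`, `0 < c ≤ klEngC₃6 P R`, `μ ∈ klWindowC`, `0 < U ≤ klEngU₀9 P R c`, `klBetaMin ≤ β ≤ e^{c/U²}`, `FrameOK R U (nScales β) μ K`,
`klEngL₃ β U ≤ L`, `klEngM₃ β U L ≤ M`), for every `1 ≤ n₂ ≤ nScales β + 1` and every resolution `m ≥ n₂ + 1`: the per-pair column sums (fine position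
summed) and row sums (coarse position summed) of `‖E(klIsoFamily … m)·S(F̃_{n₂})‖` are `≤ C_I · M/β` — i.e. `ε_x·c₁, ε_x·c₁r ≤ C_I/2`, uniform in
`n₂, m, β, L, M` and the frame. [cite: BenfattoGiulianiMastropietro2006, §2.7 (2.71a)] -/
theorem overlap_pairSums_klIso_klEng :
    ∃ CI : ℝ, 0 < CI ∧ ∀ (P : SplitConsts) (R : RenConsts) (c : ℝ), P.WF → R.WF2 → 0 < c → c ≤ klEngC₃6 P R →
      ∀ μ ∈ klWindowC, ∀ U : ℝ, 0 < U → U ≤ klEngU₀9 P R c → ∀ β : ℝ, klBetaMin ≤ β → β ≤ Real.exp (c / U ^ 2) →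
      ∀ K : TrigPolyC4v, FrameOK R U (nScales β) μ K → ∀ (L M : ℕ) [NeZero L] [NeZero M],
      klEngL₃ β U ≤ L → klEngM₃ β U L ≤ M → ∀ n₂ m : ℕ, 1 ≤ n₂ → n₂ ≤ nScales β + 1 → n₂ + 1 ≤ m →
        (∀ (σ : Fin (sectorCount (2 * m))) (ω' : Fin (sectorCount n₂)) (s c' : Fin 2) (x' : SpaceTimeIdx L M),
          ∑ x'' : SpaceTimeIdx L M, ‖(sectorAnalysisMatrix L M β (klIsoFamily L M β μ K klE0 m) *
            sectorSubMatrix L M β (bgmFatMultiplier L M klE0 β (nambuXiCT L μ K) n₂)) (x'', ((σ, s), c')) (x', ((ω', s), c'))‖ ≤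
            CI * M / β) ∧
        (∀ (σ : Fin (sectorCount (2 * m))) (ω' : Fin (sectorCount n₂)) (s c' : Fin 2) (x'' : SpaceTimeIdx L M),
          ∑ x' : SpaceTimeIdx L M, ‖(sectorAnalysisMatrix L M β (klIsoFamily L M β μ K klE0 m) *
            sectorSubMatrix L M β (bgmFatMultiplier L M klE0 β (nambuXiCT L μ K) n₂)) (x'', ((σ, s), c')) (x', ((ω', s), c'))‖ ≤
            CI * M / β) := by
  have ha : (-4 : ℝ) < -(6 / 5) := by norm_num
  have hab : (-(6 / 5) : ℝ) ≤ -(1 / 10) := by norm_num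
  have hb : (-(1 / 10) : ℝ) < 0 := by norm_num
  have he : (0 : ℝ) < klE0 := by norm_num [klE0]
  obtain ⟨CT, hCT, hT⟩ := charSum_klAnisoPair_nb_of_thresholds ha hab hb
  have hI0 : 0 ≤ klIsoT := klIsoT_nonneg
  refine ⟨81 * (klIsoT + 1) * CT, by positivity, ?_⟩
  intro P R c hP hR2 hc hc6 μ hμ U hU hU9 β hβmin hβc K hK L M _ _ hL3 hM3 n₂ m hn₂ hn₂N hm
  have hβ : 0 < β := KLRegimeSplit.pos_of_klBetaMin_le hβmin
  have hRj : ∀ j, 0 ≤ R.Gfr j := gfr_nonneg_of_wf2 hR2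
  have hLr : (0 : ℝ) < L := Nat.cast_pos.2 (Nat.pos_of_ne_zero (NeZero.ne L))
  have hMr : (0 : ℝ) < M := Nat.cast_pos.2 (Nat.pos_of_ne_zero (NeZero.ne M))
  -- the thin neighbouring pairs at `(n₂, n₂ - 1)` and the thin single at index `n₂`
  have hpair : ∀ (ω : Fin (sectorCount n₂)) (a' : Fin (sectorCount (n₂ - 1))),
      ∑ zz : TorusSite 1 (2 * M) × TorusSite 2 L,
        ‖∑ q : TorusSite 1 (2 * M) × TorusSite 2 L, (torusChar q.1 zz.1 * torusChar q.2 zz.2) •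
          (klAnisoFamily L M β μ K klE0 n₂ ω (⟨(q.1 0).val, ZMod.val_lt (q.1 0)⟩, q.2) *
            klAnisoFamily L M β μ K klE0 (n₂ - 1) a' (⟨(q.1 0).val, ZMod.val_lt (q.1 0)⟩, q.2))‖ ≤ CT * M * (L : ℝ) ^ 2 :=
    fun ω a' => hT R hRj c U hc
      (hc6.trans ((klEngC₃6_le_klEngC₃3 P R).trans (klEngC₃3_le_symbolC₃ ha hab hb P hRj))) hU
      (hU9.trans ((klEngU₀9_le_klEngU₀3 P R c).trans (klEngU₀3_le_symbolU₀ ha hab hb P hRj c)))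
      β hβmin hβc μ hμ K hK L M (sq_le_of_klEngL₃_le hL3) (le_of_klEngM₃_le hβmin hL3 hM3) n₂ hn₂ hn₂N ω a'
  have hCT0 : 0 ≤ CT * M * (L : ℝ) ^ 2 := by positivity
  have hsingle : ∀ a : Fin (sectorCount n₂), ∑ z : TorusSite 1 (2 * M) × TorusSite 2 L,
      ‖∑ q : TorusSite 1 (2 * M) × TorusSite 2 L, (torusChar q.1 z.1 * torusChar q.2 z.2) •
        klAnisoFamily L M β μ K klE0 n₂ a (⟨(q.1 0).val, ZMod.val_lt (q.1 0)⟩, q.2)‖ ≤ 27 * (CT * M * (L : ℝ) ^ 2) :=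
    fun a => charSum_klAniso_single_le β μ K hn₂ a hCT0 (fun a' => hpair a a')
  -- the iso single from the engine's isotropic torus constant
  have hiso : ∀ σ : Fin (sectorCount (2 * m)), ∑ z : TorusSite 1 (2 * M) × TorusSite 2 L,
      ‖∑ q : TorusSite 1 (2 * M) × TorusSite 2 L, (torusChar q.1 z.1 * torusChar q.2 z.2) •
        klIsoFamily L M β μ K klE0 m σ (⟨(q.1 0).val, ZMod.val_lt (q.1 0)⟩, q.2)‖ ≤ 2 * M * (L : ℝ) ^ 2 * (klIsoT + 1) := by
    intro σ
    have h4 := (TorusFourierL2.isoTorusBoundAt_klIsoT : IsoTorusBoundAt klIsoT) P R c hP hR2 hc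
      (hc6.trans (klEngC₃6_le_klEngC₃3 P R)) μ hμ U hU (hU9.trans (klEngU₀9_le_klEngU₀3 P R c)) β hβmin hβc K hK L M hL3 hM3 m σ 0
    simp only [if_true] at h4
    have h5 := charSum_klIso_single_le_of_padded hβ μ K klE0 m σ h4
    refine h5.trans ?_
    have : 2 * M * (L : ℝ) ^ 2 * klIsoT ≤ 2 * M * (L : ℝ) ^ 2 * (klIsoT + 1) := by
      refine mul_le_mul_of_nonneg_left (by linarith) (by positivity)
    exact this
  -- the per-pair sums by product-torus Young
  have hTi0 : 0 ≤ 2 * M * (L : ℝ) ^ 2 * (klIsoT + 1) := by positivity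
  have hTa0 : 0 ≤ 27 * (CT * M * (L : ℝ) ^ 2) := by positivity
  have hpr := overlap_pairSums_klIso_bgmFat_le_of_singles he hβ μ K hm hTi0 hTa0 hiso hsingle
  have hval : 3 * ((((2 * M : ℕ) : ℝ) ^ 1 * (L : ℝ) ^ 2)⁻¹ * ((2 * M * (L : ℝ) ^ 2 * (klIsoT + 1)) * (27 * (CT * M * (L : ℝ) ^ 2)))) /
      (β * (L : ℝ) ^ 2) = 81 * (klIsoT + 1) * CT * M / β := by
    push_cast
    field_simp
    ring
  refine ⟨fun σ ω' s c' x' => ?_, fun σ ω' s c' x'' => ?_⟩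
  · exact (hpr.2 σ ω' s c' x').trans (le_of_eq hval)
  · exact (hpr.1 σ ω' s c' x'').trans (le_of_eq hval)

/-! ## §4 THE CLASS-#6 DOOR: any per-thin-tuple line ⟹ `IsoTupleLineAt` -/

/-- **The iso ← thin single-tuple door, fixed-tuple form**: `∃ C_re > 0` such that, under the binders of the registered stubs of item 20437 at an
admissible frame `K` (`FrameOK R U (nScales β) μ K`), for every scale `n`, thin index `1 ≤ n₂ ≤ nScales β + 1` and size `X ≥ 0`: if every thin label tuple
`σ′` of index `n₂`, every leg `p` and every point `y` has `ε³·Σ_{x′_p = y} ‖klAnisoKernelAt … K n n₂ σ′ x′‖ ≤ X`, then for every resolution `m ≥ n₂ + 1`,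
every iso label tuple `Ω` and every `x₁`: `fixedTupleL1 β 3 (klIsoKernelAt … K n m) Ω x₁ ≤ C_re · X`. [cite: BenfattoGiulianiMastropietro2006, §2.8 (2.82)-(2.83)] -/
theorem fixedTupleL1_klIsoKernelAt_le_klEng :
    ∃ Cre : ℝ, 0 < Cre ∧ ∀ (P : SplitConsts) (R : RenConsts) (c : ℝ), P.WF → R.WF2 → 0 < c → c ≤ klEngC₃6 P R →
      ∀ μ ∈ klWindowC, ∀ U : ℝ, 0 < U → U ≤ klEngU₀9 P R c → ∀ β : ℝ, klBetaMin ≤ β → β ≤ Real.exp (c / U ^ 2) →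
      ∀ K : TrigPolyC4v, FrameOK R U (nScales β) μ K → ∀ (L M : ℕ) [NeZero L] [NeZero M],
      klEngL₃ β U ≤ L → klEngM₃ β U L ≤ M → ∀ n n₂ : ℕ, 1 ≤ n₂ → n₂ ≤ nScales β + 1 → ∀ X : ℝ, 0 ≤ X →
        (∀ (σ' : Fin 4 → SectorLeg (sectorCount n₂)) (p : Fin 4) (y : SpaceTimeIdx L M),
          imagTimeWeight β M ^ 3 * ∑ x' ∈ univ.filter (fun x' : Fin 4 → SpaceTimeIdx L M => x' p = y),
            ‖klAnisoKernelAt L M β U μ K n n₂ σ' x'‖ ≤ X) →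
        ∀ m : ℕ, n₂ + 1 ≤ m → ∀ (Ω : Fin 4 → SectorLeg (sectorCount (2 * m))) (x₁ : SpaceTimeIdx L M),
          fixedTupleL1 L M β 3 (klIsoKernelAt L M β U μ K n m) Ω x₁ ≤ Cre * X := by
  obtain ⟨CI, hCI, hI⟩ := overlap_pairSums_klIso_klEng
  refine ⟨(CI / 2) ^ 4 * 27 ^ 4, by positivity, ?_⟩
  intro P R c hP hR2 hc hc6 μ hμ U hU hU9 β hβmin hβc K hK L M _ _ hL3 hM3 n n₂ hn₂ hn₂N X hX0 hB m hm Ω x₁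
  have hβ : 0 < β := KLRegimeSplit.pos_of_klBetaMin_le hβmin
  have hMr : (0 : ℝ) < M := Nat.cast_pos.2 (Nat.pos_of_ne_zero (NeZero.ne M))
  obtain ⟨hcol, hrow⟩ := hI P R c hP hR2 hc hc6 μ hμ U hU hU9 β hβmin hβc K hK L M hL3 hM3 n₂ m hn₂ hn₂N hm
  have hc0 : 0 ≤ CI * M / β := by positivity
  refine (fixedTupleL1_klIsoKernelAt_le_of_klAniso hβ U μ K n hm hc0 hc0 hX0 hcol hrow hB Ω x₁).trans (le_of_eq ?_)
  rw [imagTimeWeight]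
  field_simp

/-- **THE CLASS-#6 DOOR** (`IsoTupleLineAt` from a per-thin-tuple line): `∃ C_re > 0` such that, under the binders of the registered stubs of item
20437 at the flowing frame `K_n = klFlowFrameU L M β U μ n` (`FrameOK R U (nScales β) μ K_n`), for `1 ≤ n₂`, `n₂ + 1 ≤ n`, `n₂ ≤ nScales β + 1` and
constants `a, b` with `0 ≤ a·U + b·(Klam U)²`: if every thin label tuple `σ′` of index `n₂`, leg `p` and point `y` has
`ε³·Σ_{x′_p = y} ‖klAnisoKernelAt … K_n n n₂ σ′ x′‖ ≤ a·U + b·(Klam U)²`, then `IsoTupleLineAt L M (C_re·a) (C_re·b) P β U μ n` — the class-#6 line at scale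
`n` with absolute constants, from a single-tuple line in THIN currency (the producer's own, e.g. `n₂ = n − 1`). -/
theorem isoTupleLineAt_of_anisoTupleLine_klEng :
    ∃ Cre : ℝ, 0 < Cre ∧ ∀ (P : SplitConsts) (R : RenConsts) (c : ℝ), P.WF → R.WF2 → 0 < c → c ≤ klEngC₃6 P R →
      ∀ μ ∈ klWindowC, ∀ U : ℝ, 0 < U → U ≤ klEngU₀9 P R c → ∀ β : ℝ, klBetaMin ≤ β → β ≤ Real.exp (c / U ^ 2) →
      ∀ (L M : ℕ) [NeZero L] [NeZero M], klEngL₃ β U ≤ L → klEngM₃ β U L ≤ M →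
      ∀ n n₂ : ℕ, 1 ≤ n₂ → n₂ + 1 ≤ n → n₂ ≤ nScales β + 1 →
      FrameOK R U (nScales β) μ (klFlowFrameU L M β U μ n) → ∀ a b : ℝ, 0 ≤ a * U + b * (P.Klam * U) ^ 2 →
        (∀ (σ' : Fin 4 → SectorLeg (sectorCount n₂)) (p : Fin 4) (y : SpaceTimeIdx L M),
          imagTimeWeight β M ^ 3 * ∑ x' ∈ univ.filter (fun x' : Fin 4 → SpaceTimeIdx L M => x' p = y),
            ‖klAnisoKernelAt L M β U μ (klFlowFrameU L M β U μ n) n n₂ σ' x'‖ ≤ a * U + b * (P.Klam * U) ^ 2) →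
        IsoTupleLineAt L M (Cre * a) (Cre * b) P β U μ n := by
  obtain ⟨Cre, hCre, h⟩ := fixedTupleL1_klIsoKernelAt_le_klEng
  refine ⟨Cre, hCre, ?_⟩
  intro P R c hP hR2 hc hc6 μ hμ U hU hU9 β hβmin hβc L M _ _ hL3 hM3 n n₂ hn₂ hn₂n hn₂N hK a b hab hB m hnm Ω _ x₁
  have hm : n₂ + 1 ≤ m := hn₂n.trans hnm
  refine (h P R c hP hR2 hc hc6 μ hμ U hU hU9 β hβmin hβc (klFlowFrameU L M β U μ n) hK L M hL3 hM3 n n₂ hn₂ hn₂N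
    (a * U + b * (P.Klam * U) ^ 2) hab hB m hm Ω x₁).trans (le_of_eq ?_)
  ring

end Summit.HubbardSuperconductivity.HubbardSuperconductivity.Theorems.EngineV8

end
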